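import Mathlib
import Literature.Analysis.FluidPDE.LeraySelfSimilarCalculus
import Literature.Analysis.FluidPDE.IsometryInvariance
import Literature.Analysis.FluidPDE.SpaceTimeCalculus
import Summits.NavierStokesRegularity.NavierStokesRegularity.Theorems.EfficiencyFloorMaximiserSetRigidityOrbitExp
import Summits.NavierStokesRegularity.NavierStokesRegularity.Theorems.EfficiencyFloorMaximiserSetRigidityOrbitTimeDeriv
import HarnessLib

/-!
# Route `EfficiencyFloor`, crux `MaximiserSetRigidity` (stmt-NavierStokesRegularity-25512), part (b), rotating case:
# the rotating self-similar orbit of a relative-equilibrium profile is a classical Navier–Stokes solution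

Helper file (`--supports stmt-NavierStokesRegularity-25512`), route-independent. Sixth brick of the orbit argument
for the driftless rotating collapse Liouville theorem (L⁺_rot) (bricks: `…RotatingDrift`, `…OrbitBlowup`,
`…OrbitL3`, `…OrbitTimeDeriv`, `…OrbitExp`). Let `m` (smooth, divergence free) and `π` (smooth) solve the
driftless relative-equilibrium equation of stmt-25512 (b),
`νΔm − (m·∇)m − ∇π = ((Wx)·∇)m − Wm + c′(m + (x·∇)m)`, `W` skew-adjoint, `c′ > 0`. With
`λ(t) = (2c′(T − t))^{-1/2}`, the phase `φ(t) = (2c′)⁻¹ log(2c′(T − t))` (`φ' = −λ²`) and the rotations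
`R(t) = exp(φ(t)W)` (linear isometries, `R(t)⁻¹ = exp(−φ(t)W)`), the ROTATING LERAY ORBIT
`u(t,x) = λ(t) R(t) m(λ(t) R(t)⁻¹ x)`, `p(t,x) = λ(t)² π(λ(t) R(t)⁻¹ x)`
is a classical solution of the unforced Navier–Stokes system on `(−∞, T) × E`
(`isClassicalNSSolutionOn_rotatingOrbit`): every term of the momentum equation at `(t,x)` is `λ³R(t)` applied
to the corresponding profile term at `y = λR⁻¹x` (time derivative: `hasDerivAt_rotatingOrbit`; convective term,
Laplacian, pressure gradient: the tree's dilation calculus `LeraySelfSimilarCalculus` conjugated by the isometry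
`R(t)`, `IsometryInvariance`).

HONEST FRAMING: a calculus brick (Leray 1934 (3.11)–(3.12) with a log-time rotation); (L⁺_rot), stmt-25512,
`ProductionEfficiencyDecay` and Navier–Stokes regularity stay OPEN; no summit statement is proved. [folklore]
-/

noncomputable section

-- the problem directory repeats the summit name (`NavierStokesRegularity/NavierStokesRegularity`)
set_option linter.dupNamespace false

namespace Summit.NavierStokesRegularity.NavierStokesRegularity.Theorems

namespace MaximiserSetRigidity

namespace RotatingOrbit

open Set Function Filter Topology InnerProductSpace
open scoped RealInnerProductSpace ContDiff Laplacian
open Literature.Analysis Literature.Analysis.FluidPDE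

variable {E : Type*} [NormedAddCommGroup E] [InnerProductSpace ℝ E] [FiniteDimensional ℝ E] [CompleteSpace E]

/-! ### The phase `φ(t) = (2c′)⁻¹ log(2c′(T − t))` -/

omit [FiniteDimensional ℝ E] [CompleteSpace E] in
/-- `φ' = −λ²` on `(−∞, T)`. [folklore] -/
theorem hasDerivAt_phase {c' T t : ℝ} (hc' : 0 < c') (ht : t < T) :
    HasDerivAt (fun s => (2 * c')⁻¹ * Real.log (2 * c' * (T - s)))
      (-(((Real.sqrt (2 * c' * (T - t)))⁻¹) ^ 2)) t := by
  have hpos := lerayScale_arg_pos hc' ht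
  have hg : HasDerivAt (fun s => 2 * c' * (T - s)) (2 * c' * (-1)) t := by
    have := ((hasDerivAt_id t).const_sub T).const_mul (2 * c')
    simpa using this
  have hlog := (hg.log hpos.ne').const_mul (2 * c')⁻¹
  refine hlog.congr_deriv ?_
  rw [lerayScale_sq hc' ht]
  field_simp

omit [FiniteDimensional ℝ E] [CompleteSpace E] in
/-- `φ` is smooth on `(−∞, T)`. [folklore] -/
theorem contDiffOn_phase {c' T : ℝ} (hc' : 0 < c') {n : WithTop ℕ∞} :
    ContDiffOn ℝ n (fun s => (2 * c')⁻¹ * Real.log (2 * c' * (T - s))) (Iio T) := by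
  have h1 : ContDiffOn ℝ n (fun s => 2 * c' * (T - s)) (Iio T) :=
    (contDiff_const.mul (contDiff_const.sub contDiff_id)).contDiffOn
  have hne : ∀ s ∈ Iio T, 2 * c' * (T - s) ≠ 0 := fun s hs => (lerayScale_arg_pos hc' hs).ne'
  exact contDiffOn_const.mul (h1.log hne)

/-! ### Spatial slices: conjugating the dilated profile by an isometry -/

omit [FiniteDimensional ℝ E] [CompleteSpace E] in
/-- Convective term of a slice: `((u·∇)u)(x) = c³ R ((m·∇)m)(c R⁻¹ x)` (the slice `y ↦ c • R (m (c • R⁻¹ y))` is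
the conjugate by `R` of the dilated profile `z ↦ c • m (c • z)`). [folklore] -/
theorem convect_slice (R : E ≃ₗᵢ[ℝ] E) (m : E → E) (c : ℝ) (x : E) :
    convect (fun y => c • R (m (c • R.symm y))) (fun y => c • R (m (c • R.symm y))) x =
      c ^ 3 • R (convect m m (c • R.symm x)) := by
  set V : E → E := fun z => c • m (c • z) with hV
  have e : (fun y => c • R (m (c • R.symm y))) = fun y => R (V (R.symm y)) := by
    funext y; simp only [hV, LinearIsometryEquiv.map_smul]
  rw [e, convect_conj_linearIsometryEquiv R, hV, convect_smul_comp_smul, LinearIsometryEquiv.map_smul]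

omit [CompleteSpace E] in
/-- Laplacian of a slice: `Δu(x) = c³ R (Δm)(c R⁻¹ x)` (`m ∈ C²`). [folklore] -/
theorem laplacian_slice (R : E ≃ₗᵢ[ℝ] E) {m : E → E} (hm : ContDiff ℝ 2 m) (c : ℝ) (x : E) :
    (Δ (fun y => c • R (m (c • R.symm y)))) x = c ^ 3 • R ((Δ m) (c • R.symm x)) := by
  set V : E → E := fun z => c • m (c • z) with hV
  have e : (fun y => c • R (m (c • R.symm y))) = fun y => R (V (R.symm y)) := by
    funext y; simp only [hV, LinearIsometryEquiv.map_smul]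
  rw [e, laplacian_conj_linearIsometryEquiv R, hV, laplacian_smul_comp_smul hm, LinearIsometryEquiv.map_smul]

omit [CompleteSpace E] in
/-- A slice of a divergence-free profile is divergence free. [folklore] -/
theorem isDivFree_slice (R : E ≃ₗᵢ[ℝ] E) {m : E → E} (hm : VectorCalculus.IsDivFree m) (c : ℝ) :
    VectorCalculus.IsDivFree (fun y => c • R (m (c • R.symm y))) := by
  set V : E → E := fun z => c • m (c • z) with hV
  have e : (fun y => c • R (m (c • R.symm y))) = fun y => R (V (R.symm y)) := by
    funext y; simp only [hV, LinearIsometryEquiv.map_smul]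
  have hV0 : VectorCalculus.IsDivFree V := fun z => by
    rw [hV, divergence_smul_comp_smul, hm, mul_zero]
  rw [e]
  exact hV0.conj_linearIsometryEquiv R

/-- Pressure gradient of a slice: `∇(c² π(c R⁻¹ ·))(x) = c³ R (∇π)(c R⁻¹ x)`. [folklore] -/
theorem gradient_pressure_slice (R : E ≃ₗᵢ[ℝ] E) (π : E → ℝ) (c : ℝ) (x : E) :
    gradient (fun y => c ^ 2 * π (c • R.symm y)) x = c ^ 3 • R (gradient π (c • R.symm x)) := by
  set Q : E → ℝ := fun z => c ^ 2 * (π (c • z) - 0) with hQ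
  have e : (fun y => c ^ 2 * π (c • R.symm y)) = fun y => Q (R.symm y) := by
    funext y; simp only [hQ, sub_zero]
  rw [e, gradient_comp_linearIsometryEquiv_symm R, hQ, gradient_sq_mul_comp_smul_sub, LinearIsometryEquiv.map_smul]

/-! ### The rotating orbit is a classical solution on `(−∞, T)` -/

/-- **The rotating Leray orbit of a relative-equilibrium profile solves Navier–Stokes classically on `(−∞, T) × E`.**
Data: `ν`, `c′ > 0`, `T`; `m` smooth divergence free and `π` smooth with
`νΔm − (m·∇)m − ∇π = ((Wx)·∇)m − Wm + c′(m + (x·∇)m)`; `λ(t) = (2c′(T−t))^{-1/2}`,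
`φ(t) = (2c′)⁻¹ log(2c′(T−t))`, `R(t)` linear isometries with `R(t) = exp(φ(t)W)`, `R(t)⁻¹ = exp(−φ(t)W)` (for a
skew-adjoint `W` these are `Unitary.linearIsometryEquiv ⟨exp(φ(t)W), _⟩`, see `…OrbitExp`; skewness itself is not
used in the computation);
`u(t,x) = λ R m(λ R⁻¹ x)`, `p(t,x) = λ² π(λ R⁻¹ x)`. Conclusion: `IsClassicalNSSolutionOn (Iio T) ν 0 u p`. [folklore] -/
theorem isClassicalNSSolutionOn_rotatingOrbit {ν c' T : ℝ} (hc' : 0 < c') {m : E → E} {π : E → ℝ}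
    {W : E →L[ℝ] E} (hm : ContDiff ℝ (⊤ : ℕ∞) m) (hπ : ContDiff ℝ (⊤ : ℕ∞) π)
    (hdiv : VectorCalculus.IsDivFree m)
    (heq : ∀ x : E, ν • Δ m x - convect m m x - gradient π x =
      (fderiv ℝ m x (W x) - W (m x)) + c' • (m x + fderiv ℝ m x x))
    (lam φ : ℝ → ℝ) (hlam : ∀ t, lam t = (Real.sqrt (2 * c' * (T - t)))⁻¹)
    (hφ : ∀ t, φ t = (2 * c')⁻¹ * Real.log (2 * c' * (T - t)))
    (Rot : ℝ → (E ≃ₗᵢ[ℝ] E)) (hRot : ∀ t v, Rot t v = NormedSpace.exp (φ t • W) v)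
    (hRot' : ∀ t v, (Rot t).symm v = NormedSpace.exp ((-φ t) • W) v)
    (u : ℝ → E → E) (p : ℝ → E → ℝ) (hu : ∀ t x, u t x = lam t • Rot t (m (lam t • (Rot t).symm x)))
    (hp : ∀ t x, p t x = lam t ^ 2 * π (lam t • (Rot t).symm x)) :
    IsClassicalNSSolutionOn (Iio T) ν 0 u p := by
  have hm2 : ContDiff ℝ 2 m := contDiff_infty.1 hm 2
  have hm1 : Differentiable ℝ m := hm.differentiable (by simp)
  -- the uncurried fields, explicitly
  have hU : uncurry u = fun q : ℝ × E => lam q.1 • NormedSpace.exp (φ q.1 • W)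
      (m (lam q.1 • NormedSpace.exp ((-φ q.1) • W) q.2)) := by
    funext q
    rcases q with ⟨t, x⟩
    simp only [uncurry_apply_pair, hu, hRot, hRot']
  have hP : uncurry p = fun q : ℝ × E => lam q.1 ^ 2 * π (lam q.1 • NormedSpace.exp ((-φ q.1) • W) q.2) := by
    funext q
    rcases q with ⟨t, x⟩
    simp only [uncurry_apply_pair, hp, hRot']
  -- smoothness of the ingredients on the slab
  have hS : ∀ q : ℝ × E, q ∈ Iio T ×ˢ (univ : Set E) → q.1 ∈ Iio T := fun q hq => (mem_prod.1 hq).1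
  have hlamS : ContDiffOn ℝ ∞ (fun q : ℝ × E => lam q.1) (Iio T ×ˢ univ) := by
    have h := (contDiffOn_lerayScale (T := T) hc' (n := ∞)).comp contDiffOn_fst hS
    refine h.congr fun q _ => ?_
    simp only [comp_apply, hlam]
  have hφS : ContDiffOn ℝ ∞ (fun q : ℝ × E => φ q.1) (Iio T ×ˢ univ) := by
    have h := (contDiffOn_phase (T := T) hc' (n := ∞)).comp contDiffOn_fst hS
    refine h.congr fun q _ => ?_
    simp only [comp_apply, hφ]
  have hexpS : ContDiffOn ℝ ∞ (fun q : ℝ × E => NormedSpace.exp (φ q.1 • W)) (Iio T ×ˢ univ) := by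
    have h := (contDiff_exp_smul W (n := ∞)).comp_contDiffOn hφS
    exact h
  have hexpS' : ContDiffOn ℝ ∞ (fun q : ℝ × E => NormedSpace.exp ((-φ q.1) • W)) (Iio T ×ˢ univ) := by
    have h := (contDiff_exp_smul W (n := ∞)).comp_contDiffOn hφS.neg
    exact h
  have hinner : ContDiffOn ℝ ∞ (fun q : ℝ × E => lam q.1 • NormedSpace.exp ((-φ q.1) • W) q.2)
      (Iio T ×ˢ univ) := hlamS.smul (hexpS'.clm_apply contDiffOn_snd)
  have hmS : ContDiffOn ℝ ∞ (fun q : ℝ × E => m (lam q.1 • NormedSpace.exp ((-φ q.1) • W) q.2))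
      (Iio T ×ˢ univ) := hm.comp_contDiffOn hinner
  have hπS : ContDiffOn ℝ ∞ (fun q : ℝ × E => π (lam q.1 • NormedSpace.exp ((-φ q.1) • W) q.2))
      (Iio T ×ˢ univ) := hπ.comp_contDiffOn hinner
  refine ⟨?_, ?_, ?_, ?_⟩
  · -- joint smoothness of the velocity
    show ContDiffOn ℝ ∞ (uncurry u) (Iio T ×ˢ univ)
    rw [hU]
    exact hlamS.smul (hexpS.clm_apply hmS)
  · -- joint smoothness of the pressure
    show ContDiffOn ℝ ∞ (uncurry p) (Iio T ×ˢ univ)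
    rw [hP]
    exact (hlamS.pow 2).mul hπS
  · -- the momentum equation
    intro t ht x
    have htT : t < T := ht
    have hl0 : 0 < lam t := by rw [hlam]; exact lerayScale_pos hc' htT
    set y : E := lam t • (Rot t).symm x with hy_def
    -- time derivative
    have hline : (fun s => u s x) = fun s => lam s • (NormedSpace.exp (φ s • W))
        (m (lam s • (NormedSpace.exp ((-φ s) • W)) x)) := by
      funext s
      simp only [hu, hRot, hRot']
    have hlam' : HasDerivAt lam (c' * lam t ^ 3) t := by
      have h := hasDerivAt_lerayScale (T := T) hc' htT
      have e : lam = fun s => (Real.sqrt (2 * c' * (T - s)))⁻¹ := funext hlam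
      rw [e]
      exact h
    have hφ' : HasDerivAt φ (-(lam t ^ 2)) t := by
      have h := hasDerivAt_phase (T := T) hc' htT
      have e : φ = fun s => (2 * c')⁻¹ * Real.log (2 * c' * (T - s)) := funext hφ
      rw [e, hlam]
      exact h
    obtain ⟨hRc, hRc'⟩ := hasDerivAt_exp_paths W hφ'
    have hyR : lam t • (NormedSpace.exp ((-φ t) • W)) x = y := by rw [hy_def, hRot']
    have hD : HasDerivAt (fun s => u s x)
        (lam t ^ 3 • (NormedSpace.exp (φ t • W)) (c' • (m y + fderiv ℝ m y y) +
          (fderiv ℝ m y (W y) - W (m y)))) t := by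
      rw [hline]
      exact hasDerivAt_rotatingOrbit x y hlam' hl0.ne' hRc hRc'
        (fun v => exp_smul_apply_comm W (-φ t) v) hyR (hm1 y)
    have hTD : timeDerivWithin (Iio T) u t x = lam t ^ 3 • Rot t (c' • (m y + fderiv ℝ m y y) +
        (fderiv ℝ m y (W y) - W (m y))) := by
      rw [timeDerivWithin_eq_deriv isOpen_Iio ht, hD.deriv, hRot]
    -- spatial terms
    have hut : u t = fun z => lam t • Rot t (m (lam t • (Rot t).symm z)) := funext (hu t)
    have hpt : p t = fun z => lam t ^ 2 * π (lam t • (Rot t).symm z) := funext (hp t)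
    have hC : convect (u t) (u t) x = lam t ^ 3 • Rot t (convect m m y) := by
      rw [hut, convect_slice]
    have hL : (Δ (u t)) x = lam t ^ 3 • Rot t ((Δ m) y) := by
      rw [hut, laplacian_slice (Rot t) hm2]
    have hG : gradient (p t) x = lam t ^ 3 • Rot t (gradient π y) := by
      rw [hpt, gradient_pressure_slice]
    rw [hTD, hC, hL, hG]
    simp only [Pi.zero_apply, add_zero]
    -- the profile equation at `y`
    have key : ν • Δ m y - convect m m y - gradient π y -
        ((fderiv ℝ m y (W y) - W (m y)) + c' • (m y + fderiv ℝ m y y)) = 0 := sub_eq_zero.2 (heq y)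
    have key' : c' • (m y + fderiv ℝ m y y) + (fderiv ℝ m y (W y) - W (m y)) + convect m m y =
        ν • Δ m y - gradient π y := by
      rw [← sub_eq_zero]
      calc c' • (m y + fderiv ℝ m y y) + (fderiv ℝ m y (W y) - W (m y)) + convect m m y -
            (ν • Δ m y - gradient π y)
          = -(ν • Δ m y - convect m m y - gradient π y -
              ((fderiv ℝ m y (W y) - W (m y)) + c' • (m y + fderiv ℝ m y y))) := by abel
        _ = 0 := by rw [key, neg_zero]
    rw [← smul_add, ← map_add, key', map_sub, LinearIsometryEquiv.map_smul]
    module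
  · -- incompressibility
    intro t ht
    have hut : u t = fun z => lam t • Rot t (m (lam t • (Rot t).symm z)) := funext (hu t)
    rw [hut]
    exact isDivFree_slice (Rot t) hdiv (lam t)

end RotatingOrbit

end MaximiserSetRigidity

end Summit.NavierStokesRegularity.NavierStokesRegularity.Theorems

end
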